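import Literature.AlgebraicGeometry.HodgeTheory.HardLefschetzProductsFactors
import HarnessLib

/-!
# Polarization classes and hard Lefschetz classes are stable under non-zero (rational) scalars; weighted product
# classes `a · pr_Y^* η + b · pr_Z^* η'`

Family `hodge`, lane `lit-hodgefound` (Track 2 foundations library), layer `Literature/AlgebraicGeometry/HodgeTheory`,
namespace `Literature.AlgebraicGeometry.HodgeTheory`; prover seat `lit-hodgefound-p21` (generation 36, row g36-#8), a
rider on `HardLefschetzNFoldHolds` (`HasHardLefschetzProperty.smul`: `Lʲ_{w κ} = wʲ Lʲ_κ`) and on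
`HardLefschetzProductsFactors` (g36-#4: `pr_Y^* η + pr_Z^* η'` is hard Lefschetz / a polarization class iff `η`, `η'`
are).  The three components of `IsPolarizationClass` (rational, supported on a divisor, hard Lefschetz) are invariant
under `η ↦ q • η` for a non-zero RATIONAL `q` (in print: `L` is ample iff `L^{⊗k}` is, `k ≥ 1`, and `c₁(L^{⊗k}) = k c₁(L)`;
the sign is invisible to the three components), so Milne's product divisor with multiplicities
`D = a · (D_Y × Z) + b · (Y × D_Z)` has a polarization class iff `D_Y`, `D_Z` do.  THEOREMS ONLY (no definition, no
named fact, no instance; D-0026 net debt `0`).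

## Sources

* C. Voisin, *Hodge Theory and Complex Algebraic Geometry I* (2002) [VoisinHodgeI2002], Thm. 6.25 and Rem. 6.27 (hard
  Lefschetz for `[ω]`; the statement only depends on the line `ℂ·[ω]`), §7.1.2 (integral/rational classes), §11.3.3
  Thm. 11.38 (Künneth).
* Ch. Birkenhake, H. Lange, *Complex Abelian Varieties* (1992) [LangeBirkenhake1992], §4.1 and Prop. 4.5.2 (`L` ample iff
  `Lⁿ` ample, `n ≥ 1`), §5.3 (products of polarized abelian varieties).
* J. S. Milne, *Lefschetz classes on abelian varieties*, Duke Math. J. **96** (1999) [Milne1999LefschetzClasses], §1 p. 643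
  («`D = Σᵢ A₁ × ⋯ × Dᵢ × ⋯ × A_s` is an ample divisor on `A`»).
* T. Harima et al., *The Lefschetz Properties*, LNM 2080 (2013) [HarimaEtAl2013], Thm. 3.34, Prop. 3.67 (the tensor
  criterion behind `hasHardLefschetzProperty_map_fst_add_map_snd_iff`).
* A. Hatcher, *Algebraic Topology* (2002) [HatcherAT2002], §3.1 (coefficients; rational classes form a `ℚ`-structure).

## WHAT IS PROVED

* §1 `hasHardLefschetzProperty_smul_iff` (`w ≠ 0` complex), `hasHardLefschetzProperty_neg_iff`.
* §2 `IsPolarizationClass.smul` / `isPolarizationClass_smul_iff` (`q ≠ 0` rational), `IsPolarizationClass.neg` /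
  `isPolarizationClass_neg_iff`, `IsPolarizationClass.nsmul`, `IsPolarizationClass.zsmul`.
* §3 (with `HardLefschetzProductsFactors`) **`hasHardLefschetzProperty_smul_map_fst_add_smul_map_snd_iff`**
  (`a · pr_Y^* η + b · pr_Z^* η'` is hard Lefschetz in dimension `m + n` iff `η`, `η'` are, `a, b ∈ ℂˣ`),
  **`isPolarizationClass_smul_map_fst_add_smul_map_snd_iff`** (it is a polarization class of `Y × Z` iff `η`, `η'` are
  polarization classes, `a, b ∈ ℚˣ`), and the `ℕ`-weighted form `isPolarizationClass_nsmul_map_fst_add_nsmul_map_snd_iff`.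

## References

* [VoisinHodgeI2002] C. Voisin, *Hodge Theory and Complex Algebraic Geometry I* (2002), Thm. 6.25, Rem. 6.27, §7.1.2, Thm. 11.38.
* [LangeBirkenhake1992] Ch. Birkenhake, H. Lange, *Complex Abelian Varieties* (1992), §4.1, Prop. 4.5.2, §5.3.
* [Milne1999LefschetzClasses] J. S. Milne, Duke Math. J. 96 (1999), §1 p. 643.
* [HarimaEtAl2013] T. Harima et al., LNM 2080 (2013), Thm. 3.34, Prop. 3.67.
* [HatcherAT2002] A. Hatcher, *Algebraic Topology* (2002), §3.1.
-/

noncomputable section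

open CategoryTheory MonoidalCategory CartesianMonoidalCategory
open Literature.AlgebraicTopology.SingularHomology
open Literature.AlgebraicGeometry.Motives
open Literature.Geometry.Kaehler

namespace Literature.AlgebraicGeometry.HodgeTheory

/-! ### §1 Hard Lefschetz is a property of the line `ℂ · κ` -/

section HardLefschetz

variable {T : Type*} [TopologicalSpace T] {κ : singularCohomology ℂ ℂ T 2} {m : ℕ}

/-- **`w • κ` is hard Lefschetz iff `κ` is, `w ≠ 0`** (`Lʲ_{wκ} = wʲ Lʲ_κ`). [cite: VoisinHodgeI2002, Thm. 6.25 and Rem. 6.27] -/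
theorem hasHardLefschetzProperty_smul_iff {w : ℂ} (hw : w ≠ 0) :
    HasHardLefschetzProperty (w • κ) m ↔ HasHardLefschetzProperty κ m := by
  refine ⟨fun h ↦ ?_, fun h ↦ HasHardLefschetzProperty.smul h hw⟩
  have h1 := HasHardLefschetzProperty.smul h (inv_ne_zero hw)
  rwa [smul_smul, inv_mul_cancel₀ hw, one_smul] at h1

/-- **`-κ` is hard Lefschetz iff `κ` is.** [cite: VoisinHodgeI2002, Thm. 6.25 and Rem. 6.27] -/
theorem hasHardLefschetzProperty_neg_iff : HasHardLefschetzProperty (-κ) m ↔ HasHardLefschetzProperty κ m := by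
  rw [← neg_one_smul ℂ κ]
  exact hasHardLefschetzProperty_smul_iff (neg_ne_zero.2 one_ne_zero)

end HardLefschetz

/-! ### §2 Polarization classes under non-zero rational scalars -/

section Polarization

variable {n : ℕ} {X : SchemeOver ℂ} {η : complexBetti X 2}

/-- **`q • η` is a polarization class for `η` a polarization class and `q ≠ 0` rational** (rational: `ℚ`-structure;
divisorial: `N¹ H²` is a subspace; hard Lefschetz: `Lʲ_{qη} = qʲ Lʲ_η`).  In print: `c₁(L^{⊗k}) = k c₁(L)` and `L`
is ample iff `L^{⊗k}` is. [cite: LangeBirkenhake1992, §4.1 and Prop. 4.5.2] [cite: VoisinHodgeI2002, Thm. 6.25 and §7.1.2] -/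
theorem IsPolarizationClass.smul (hη : IsPolarizationClass n X η) {q : ℚ} (hq : q ≠ 0) :
    IsPolarizationClass n X ((q : ℂ) • η) where
  isRationalClass := hη.isRationalClass.smul q
  mem_algebraicClasses := Submodule.smul_mem _ _ hη.mem_algebraicClasses
  hasHardLefschetz := HasHardLefschetzProperty.smul hη.hasHardLefschetz (by exact_mod_cast hq)

/-- **`q • η` is a polarization class iff `η` is, `q ≠ 0` rational.** [cite: LangeBirkenhake1992, §4.1 and Prop. 4.5.2]
[cite: VoisinHodgeI2002, Thm. 6.25 and §7.1.2] -/
theorem isPolarizationClass_smul_iff {q : ℚ} (hq : q ≠ 0) :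
    IsPolarizationClass n X ((q : ℂ) • η) ↔ IsPolarizationClass n X η := by
  refine ⟨fun h ↦ ?_, fun h ↦ h.smul hq⟩
  have h1 := h.smul (inv_ne_zero hq)
  rwa [smul_smul, ← Rat.cast_mul, inv_mul_cancel₀ hq, Rat.cast_one, one_smul] at h1

/-- `-η` is a polarization class when `η` is (the three components do not see the sign).
[cite: VoisinHodgeI2002, Thm. 6.25 and §7.1.2] -/
theorem IsPolarizationClass.neg (hη : IsPolarizationClass n X η) : IsPolarizationClass n X (-η) := by
  have h1 := hη.smul (q := -1) (by norm_num)
  rwa [Rat.cast_neg, Rat.cast_one, neg_one_smul] at h1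

/-- `-η` is a polarization class iff `η` is. [cite: VoisinHodgeI2002, Thm. 6.25 and §7.1.2] -/
theorem isPolarizationClass_neg_iff : IsPolarizationClass n X (-η) ↔ IsPolarizationClass n X η :=
  ⟨fun h ↦ by simpa using h.neg, fun h ↦ h.neg⟩

/-- `k • η` (`k ≥ 1` an integer multiple: `c₁(L^{⊗k})`) is a polarization class when `η` is.
[cite: LangeBirkenhake1992, §4.1 and Prop. 4.5.2] -/
theorem IsPolarizationClass.nsmul (hη : IsPolarizationClass n X η) {k : ℕ} (hk : k ≠ 0) :
    IsPolarizationClass n X (k • η) := by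
  have h1 := hη.smul (q := k) (by exact_mod_cast hk)
  rwa [Rat.cast_natCast, Nat.cast_smul_eq_nsmul] at h1

/-- `k • η`, `k` a non-zero integer, is a polarization class when `η` is. [cite: LangeBirkenhake1992, §4.1 and Prop. 4.5.2] -/
theorem IsPolarizationClass.zsmul (hη : IsPolarizationClass n X η) {k : ℤ} (hk : k ≠ 0) :
    IsPolarizationClass n X (k • η) := by
  have h1 := hη.smul (q := k) (by exact_mod_cast hk)
  rwa [Rat.cast_intCast, Int.cast_smul_eq_zsmul] at h1

/-- `k • η` is a polarization class iff `η` is, `k ≥ 1`. [cite: LangeBirkenhake1992, §4.1 and Prop. 4.5.2] -/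
theorem isPolarizationClass_nsmul_iff {k : ℕ} (hk : k ≠ 0) : IsPolarizationClass n X (k • η) ↔ IsPolarizationClass n X η := by
  rw [← Nat.cast_smul_eq_nsmul ℂ, ← Rat.cast_natCast]
  exact isPolarizationClass_smul_iff (by exact_mod_cast hk)

end Polarization

/-! ### §3 Weighted product classes `a · pr_Y^* η + b · pr_Z^* η'` -/

section Products

variable {m n : ℕ} {Y Z : SchemeOver ℂ}

/-- **`a · pr_Y^* η + b · pr_Z^* η'` (`a, b ≠ 0` complex) is hard Lefschetz in dimension `m + n` iff `η` and `η'` are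
hard Lefschetz in dimensions `m`, `n`** (`= pr_Y^*(aη) + pr_Z^*(bη')`, then `HardLefschetzProductsFactors` and §1).
[cite: HarimaEtAl2013, Thm. 3.34 and Prop. 3.67] [cite: VoisinHodgeI2002, Thm. 6.25 and Thm. 11.38] -/
theorem hasHardLefschetzProperty_smul_map_fst_add_smul_map_snd_iff (hY : IsSmoothProjective m Y)
    (hZ : IsSmoothProjective n Z) {a b : ℂ} (ha : a ≠ 0) (hb : b ≠ 0) {η : complexBetti Y 2} {η' : complexBetti Z 2} :
    HasHardLefschetzProperty (a • complexBetti.map (fst Y Z) 2 η + b • complexBetti.map (snd Y Z) 2 η') (m + n) ↔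
      HasHardLefschetzProperty η m ∧ HasHardLefschetzProperty η' n := by
  rw [← map_smul, ← map_smul, hasHardLefschetzProperty_map_fst_add_map_snd_iff hY hZ,
    hasHardLefschetzProperty_smul_iff ha, hasHardLefschetzProperty_smul_iff hb]

/-- **`a · pr_Y^* η + b · pr_Z^* η'` (`a, b ≠ 0` rational) is a polarization class of `Y × Z` (dimension `m + n`) iff
`η`, `η'` are polarization classes of `Y`, `Z`** — Milne's product divisor with multiplicities
`a · (D_Y × Z) + b · (Y × D_Z)`. [cite: Milne1999LefschetzClasses, §1 p. 643] [cite: LangeBirkenhake1992, §5.3 and Prop. 4.5.2]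
[cite: HarimaEtAl2013, Thm. 3.34 and Prop. 3.67] -/
theorem isPolarizationClass_smul_map_fst_add_smul_map_snd_iff (hY : IsSmoothProjective m Y)
    (hZ : IsSmoothProjective n Z) {a b : ℚ} (ha : a ≠ 0) (hb : b ≠ 0) {η : complexBetti Y 2} {η' : complexBetti Z 2} :
    IsPolarizationClass (m + n) (Y ⊗ Z)
        ((a : ℂ) • complexBetti.map (fst Y Z) 2 η + (b : ℂ) • complexBetti.map (snd Y Z) 2 η') ↔
      IsPolarizationClass m Y η ∧ IsPolarizationClass n Z η' := by
  rw [← map_smul, ← map_smul, isPolarizationClass_map_fst_add_map_snd_iff hY hZ, isPolarizationClass_smul_iff ha,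
    isPolarizationClass_smul_iff hb]

/-- The `ℕ`-weighted form: `k · pr_Y^* η + l · pr_Z^* η'` (`k, l ≥ 1`) is a polarization class of `Y × Z` iff `η`, `η'`
are polarization classes. [cite: Milne1999LefschetzClasses, §1 p. 643] [cite: LangeBirkenhake1992, §5.3 and Prop. 4.5.2] -/
theorem isPolarizationClass_nsmul_map_fst_add_nsmul_map_snd_iff (hY : IsSmoothProjective m Y)
    (hZ : IsSmoothProjective n Z) {k l : ℕ} (hk : k ≠ 0) (hl : l ≠ 0) {η : complexBetti Y 2} {η' : complexBetti Z 2} :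
    IsPolarizationClass (m + n) (Y ⊗ Z)
        (k • complexBetti.map (fst Y Z) 2 η + l • complexBetti.map (snd Y Z) 2 η') ↔
      IsPolarizationClass m Y η ∧ IsPolarizationClass n Z η' := by
  rw [← map_nsmul, ← map_nsmul, isPolarizationClass_map_fst_add_map_snd_iff hY hZ, isPolarizationClass_nsmul_iff hk,
    isPolarizationClass_nsmul_iff hl]

end Products

end Literature.AlgebraicGeometry.HodgeTheory

end
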